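import Literature.MathematicalPhysics.QuantumFieldTheory.King1986.CovarianceSplitting
import Summits.QuantumFields.YangMills.Theorems.BalabanUVNodesN15KingModelPotentialDressedTower

/-!
# BalabanUVNodes ∕ N15 — THE KING MODEL, PART 10b: THE DRESSED MINIMISER `ℋ_w = a_kN^{d+1}(A₀ + diag w)⁻¹Qᵀ` — resolvent fixed point
# `ℋ_w = ℋ − N^{−(d+1)}·G·diag(w)·ℋ_w`, the EXACT formula `Δ^{(k)}_w − Δ^{(k)} = N^{−(d+1)}·ℋᵀ·diag(w)·ℋ_w`, and the sup-norm SIZE and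
# TWO-SPACING bounds of `ℋ_w` by an ℓ^∞ Neumann argument in the window `C_M·sup|w| ≤ 1∕2` (Track A, DAG node N15 = NE2; FAN-OUT v1.1 §N15 s3)

HONEST FRAMING.  Count-neutral kernel bookkeeping (cell `pub-ymgap`, seat `pub-ymgap-dag-n15-d` g8; `--supports stmt-QuantumFields-20292
--as helper` = K3⁗ `SpineGivenEndpointR13Sep`; lineage K3 19676 → K3′ 19908 → K3‴ 19912).  King's `A = 0` SCALAR block-spin tower
([King1986] §2.2 (2.13)–(2.15) p. 653, §4 (4.5) p. 670) dressed by a fine-lattice POTENTIAL `w` (a multiplication operator added to King's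
fine operator `A₀`: part 8d's `fineOpPot` ∕ `effLaplacianPot`); the potential is NOT a gauge field; nothing here is Bałaban's `Δ^{(k)}(U) − Δ^{(k)}(1)`
∕ `H_k(U)`; NOT a node discharge; nothing continuum ∕ ℝ⁴ ∕ OS ∕ mass-gap ∕ Clay.  0 `sorry`, 1 `def` (`kingHPot`), standard axioms.
THE POINT.  Part 9d READ the two-spacing RATE letter (3.36)∕(H3) of the FULL perturbation `E_k(v) = Δ^{(k)}_v − Δ^{(k)}` (parts 8a∕8b proved it
for the first variation only).  The nonperturbative mechanism is the DRESSED MINIMISER.  With `A₀` King's fine operator at level `k` (`N = L^k`,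
`a_k = aK a L k`, `c = N²`), `G = N^{d+1}A₀⁻¹` (`constrainedProp`) and `ℋ = a_kN^{d+1}A₀⁻¹Qᵀ` (`kingH`):
* §1 def **`kingHPot`** (`ℋ_w`); `kingHPot_zero`; ★ **`kingHPot_fixedPoint`** — the second resolvent identity read as `ℋ_w(x, b) = ℋ(x, b) −
  N^{−(d+1)}Σ_y G(x, y)w(y)ℋ_w(y, b)`; ★ **`effLaplacianPot_sub_apply`** — `(Δ_eff(w) − Δ_eff)(b, b′) = N^{−(d+1)}Σ_x ℋ(x, b)w(x)ℋ_w(x, b′)` EXACTLY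
  (part 8d's envelope formula is its linearisation `ℋ_w ↦ ℋ`);
* §2 `sup_bound_of_affine` (`f ≤ α + β·sup f`, `β ≤ 1∕2` ⇒ `f ≤ 2α`); ★ **`kingHPot_abs_le`** — `sup|ℋ_w| ≤ 2c_H` in the window `C_M·sup|w| ≤ 1∕2`
  (`C_M ≥` the Riemann mass `N^{−(d+1)}Σ_y|G(x, y)|`, part 10a);
* §3 ★★ **`kingHPot_step_le`** — TWO-SPACING SUP BOUND: runs `L^k`, `L·L^k`; potentials `w, w′` of size `≤ w₀` in the window, coherence defect
  `|w′(y′) − w(y)| ≤ ν` (`y` under `y′`, King's pairing `underPtN`):  `sup_{x′}|ℋ′_{w′}(x′, b) − ℋ_w(x, b)| ≤ 2(D₀ + R·w₀H′ + C_M·νH′)`, `D₀ ≥` the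
  undressed step (Prop. 3.8 (3.71) line 1), `R ≥` the Riemann-sum two-spacing rate of `G` (part 10a), `H′ ≥ sup|ℋ′_{w′}|`;
* §4 ★★ **`effLaplacianPot_sub_step_le`** — `|E′(w′)(b, b′) − E(w)(b, b′)| ≤ K_{d+1}(δ)·(D₁w₀H′ + c_H(νH′ + w₀S_d))` with the DECAYING step∕size
  letters `D₁, c_H` of `ℋ` and the dressed step `S_d` of §3 (fibre identity `avg_comp_underPtN`, telescoping, one block sum (4.41)).
All letters are numerical hypotheses; part 10c discharges them along King's run (parts 8b, 9a∕9c, 10a) and assembles `EffectiveOperatorSupRate`.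
HONEST SCOPE.  (i) any unit torus and fine count in §1–§2; §3–§4 in the two-run format `L^k`, `L·L^k` of parts 8a–8c; (ii) SUP bounds in the fine
point (no decay of `ℋ_w` claimed — enough for the sup-norm letter (H3)); (iii) scalar potential, `A = 0`; (iv) §1 is elementary linear algebra
(second resolvent identity), not a printed proposition of [King1986]; not a discharge.
Locators: [King1986] C. King, CMP **102** (1986) 649–677: (2.13)–(2.15) p. 653 (energy, minimiser `ℋ_k = a_kG_kQ_k^*`), (4.5) p. 670, Theorem
3.3 (3.7) p. 658, Prop. 3.8 (3.71) p. 664 and p. 664 (the pairing `x′ ∈ B^n(x)`), (4.39)–(4.41) p. 675; [B9] = [Balaban1985BackgroundPropagators]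
(3.35)–(3.36) p. 396 (the two regularity slots: typing template).
-/

noncomputable section

open scoped BigOperators Matrix
open Finset

namespace Summit.QuantumFields.YangMills.BalabanUVNodes.N15.KingModel

open Literature.MathematicalPhysics.QuantumFieldTheory.Balaban1983to89 hiding blockOf
open Literature.MathematicalPhysics.QuantumFieldTheory.Balaban1983to89.B4Sect5Proof (latticeConst latticeConst_nonneg)
open Literature.MathematicalPhysics.QuantumFieldTheory.Balaban1983to89.B5Prop11Plancherel (Tor fine)
open Literature.MathematicalPhysics.QuantumFieldTheory.King1986 (aK aK_pos inv_sub_inv_of_isUnit)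
open Literature.MathematicalPhysics.QuantumFieldTheory.King1986.Torus
open Summit.QuantumFields.YangMills.BalabanUVNodes.N15KingModelRung (kingH)
open Summit.QuantumFields.YangMills.BalabanUVNodes.N15KingModelRung.Curved (underPtN val_underPtN blockOf_underPtN)

variable {d : ℕ}
/-! ## §1 The dressed minimiser kernel, its resolvent fixed point, and the exact formula for `Δ_w − Δ` -/

section Objects
variable (L : ℕ) (Nf : ℕ) [NeZero Nf] (U : Fin (d + 1) → ℕ) [∀ μ, NeZero (U μ)] (a m2 : ℝ)
/-- **THE DRESSED MINIMISER KERNEL** `ℋ_w(x, b) = a_kN^{d+1}·((A₀ + diag w)⁻¹Qᵀ)(x, b)` — King's minimiser kernel `ℋ_k = a_kG_kQ_k^*` of the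
block-spin energy WITH THE POTENTIAL `N^{−(d+1)}⟨ψ, wψ⟩` added (the minimiser of the dressed energy at the point source `δ_b`; at `w = 0` it is
part 8a's `kingH`, `kingHPot_zero`).  `Nf` fine points per unit side, level `k` (`a_k = aK a L k`, `c = N_f²`). [cite: King1986, (2.13)–(2.15) p.653, (4.5) p.670] -/
def kingHPot (k : ℕ) (w : Tor (fine Nf U) → ℝ) (b : Tor U) (x : Tor (fine Nf U)) : ℝ :=
  (aK a L k * ((Nf : ℕ) : ℝ) ^ (d + 1)) *
    ((fineOpPot Nf U (aK a L k) (((Nf : ℕ) : ℝ) ^ 2) m2 w)⁻¹ * (Qmat Nf U)ᵀ) x b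

variable {L Nf U a m2}
/-- The dressed fine operator at the zero potential (spelled `0`) is King's `A₀`. [folklore] -/
theorem fineOpPot_zero' {N : ℕ} [NeZero N] (c : ℝ) : fineOpPot N U a c m2 0 = fineOp N U a c m2 :=
  fineOpPot_zero

/-- At the zero potential the dressed minimiser is King's minimiser kernel (part 8a's `kingH`). [cite: King1986, (2.15) p.653] -/
theorem kingHPot_zero (k : ℕ) (b : Tor U) (x : Tor (fine Nf U)) : kingHPot L Nf U a m2 k 0 b x = kingH L Nf U a m2 k b x := by
  rw [kingHPot, fineOpPot_zero']
  exact (minimiser_single_apply b x).symm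

/-- `(A₀ + diag w) − A₀ = diag w`. [folklore] -/
theorem fineOpPot_sub_fineOp {N : ℕ} [NeZero N] (c : ℝ) (w : Tor (fine N U) → ℝ) :
    fineOpPot N U a c m2 w - fineOp N U a c m2 = Matrix.diagonal w := by
  rw [fineOpPot]; abel

/-- **THE SECOND RESOLVENT IDENTITY FOR THE DRESSED FINE OPERATOR**: `(A₀ + diag w)⁻¹ = A₀⁻¹ − A₀⁻¹·diag(w)·(A₀ + diag w)⁻¹` (both invertible).
[folklore] -/
theorem fineOpPot_inv_eq {N : ℕ} [NeZero N] {c : ℝ} {w : Tor (fine N U) → ℝ} (hA : IsUnit (fineOp N U a c m2))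
    (hB : IsUnit (fineOpPot N U a c m2 w)) :
    (fineOpPot N U a c m2 w)⁻¹ = (fineOp N U a c m2)⁻¹ - (fineOp N U a c m2)⁻¹ * Matrix.diagonal w * (fineOpPot N U a c m2 w)⁻¹ := by
  have h := inv_sub_inv_of_isUnit (fineOp N U a c m2) (fineOpPot N U a c m2 w) hA hB
  rw [fineOpPot_sub_fineOp] at h
  rw [← h]; abel

/-- Entries of `A₀⁻¹` are `N^{−(d+1)}` times King's fluctuation propagator `G = constrainedProp`. [cite: King1986, (2.13) p.653, (4.44) p.675] -/
theorem fineOp_inv_apply_eq {N : ℕ} [NeZero N] (c : ℝ) (x y : Tor (fine N U)) :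
    (fineOp N U a c m2)⁻¹ x y = (((N : ℕ) : ℝ) ^ (d + 1))⁻¹ * constrainedProp N U a c m2 x y := by
  have hN : ((N : ℕ) : ℝ) ^ (d + 1) ≠ 0 := pow_ne_zero _ (Nat.cast_ne_zero.mpr (NeZero.ne N))
  rw [constrainedProp, Matrix.smul_apply, smul_eq_mul, ← mul_assoc, inv_mul_cancel₀ hN, one_mul]

/-- `A₀⁻¹Qᵀ = (QA₀⁻¹)ᵀ` (`A₀` is symmetric). [folklore] -/
theorem fineOp_inv_mul_transpose_Qmat {N : ℕ} [NeZero N] (c : ℝ) :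
    (fineOp N U a c m2)⁻¹ * (Qmat N U)ᵀ = (Qmat N U * (fineOp N U a c m2)⁻¹)ᵀ := by
  rw [Matrix.transpose_mul, Matrix.transpose_nonsing_inv, fineOp_transpose]

/-- **THE DRESSED MINIMISER IS A RESOLVENT FIXED POINT**: `ℋ_w(x, b) = ℋ(x, b) − N^{−(d+1)}·Σ_y G(x, y)·w(y)·ℋ_w(y, b)` whenever `A₀ + diag w`
is invertible (`a_k ≥ 0`, `m² > 0` make `A₀` invertible).  This is the linear equation the two-spacing argument of §3 iterates.
[cite: King1986, (2.13)–(2.15) p.653] -/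
theorem kingHPot_fixedPoint {k : ℕ} (hak : 0 ≤ aK a L k) (hm : 0 < m2) {w : Tor (fine Nf U) → ℝ}
    (hB : IsUnit (fineOpPot Nf U (aK a L k) (((Nf : ℕ) : ℝ) ^ 2) m2 w)) (b : Tor U) (x : Tor (fine Nf U)) :
    kingHPot L Nf U a m2 k w b x = kingH L Nf U a m2 k b x
      - (((Nf : ℕ) : ℝ) ^ (d + 1))⁻¹ *
        ∑ y, constrainedProp Nf U (aK a L k) (((Nf : ℕ) : ℝ) ^ 2) m2 x y * w y * kingHPot L Nf U a m2 k w b y := by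
  have hA : IsUnit (fineOp Nf U (aK a L k) (((Nf : ℕ) : ℝ) ^ 2) m2) := fineOp_isUnit Nf U hak (by positivity) hm
  have hres := fineOpPot_inv_eq hA hB
  have hL : kingHPot L Nf U a m2 k w b x = (aK a L k * ((Nf : ℕ) : ℝ) ^ (d + 1)) *
      ((fineOpPot Nf U (aK a L k) (((Nf : ℕ) : ℝ) ^ 2) m2 w)⁻¹ * (Qmat Nf U)ᵀ) x b := rfl
  rw [hL, hres, Matrix.sub_mul, Matrix.sub_apply, mul_sub]
  congr 1
  · rw [← kingHPot_zero, kingHPot, fineOpPot_zero']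
  · rw [Matrix.mul_assoc ((fineOp Nf U (aK a L k) (((Nf : ℕ) : ℝ) ^ 2) m2)⁻¹ * Matrix.diagonal w), Matrix.mul_apply, mul_sum, mul_sum]
    refine sum_congr rfl fun y _ => ?_
    rw [Matrix.mul_diagonal, fineOp_inv_apply_eq, kingHPot]
    ring

/-- **THE EXACT FORMULA FOR THE FULL PERTURBATION**: `(Δ_eff(w) − Δ_eff)(b, b′) = N^{−(d+1)}·Σ_x ℋ(x, b)·w(x)·ℋ_w(x, b′)` — King's effective
Laplacian dressed by the potential MINUS the undressed one is the `ℋ`–`ℋ_w` sandwich of the potential, with NO higher-order remainder (part 8d's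
`hasDerivAt_effLaplacianPot_apply` is its linearisation `ℋ_w ↦ ℋ`; part 9b's `effLaplacianPot_taylor2_le` its second-order expansion).
[cite: King1986, (2.13)–(2.15) p.653, (4.5) p.670, (4.39) p.674] -/
theorem effLaplacianPot_sub_apply {k : ℕ} (hak : 0 ≤ aK a L k) (hm : 0 < m2) {w : Tor (fine Nf U) → ℝ}
    (hB : IsUnit (fineOpPot Nf U (aK a L k) (((Nf : ℕ) : ℝ) ^ 2) m2 w)) (b b' : Tor U) :
    (effLaplacianPot Nf U (aK a L k) (((Nf : ℕ) : ℝ) ^ 2) m2 w - effLaplacian Nf U (aK a L k) (((Nf : ℕ) : ℝ) ^ 2) m2) b b'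
      = (((Nf : ℕ) : ℝ) ^ (d + 1))⁻¹ * ∑ x, kingH L Nf U a m2 k b x * w x * kingHPot L Nf U a m2 k w b' x := by
  have hA : IsUnit (fineOp Nf U (aK a L k) (((Nf : ℕ) : ℝ) ^ 2) m2) := fineOp_isUnit Nf U hak (by positivity) hm
  have hN : ((Nf : ℕ) : ℝ) ^ (d + 1) ≠ 0 := pow_ne_zero _ (Nat.cast_ne_zero.mpr (NeZero.ne Nf))
  have hres : (fineOp Nf U (aK a L k) (((Nf : ℕ) : ℝ) ^ 2) m2)⁻¹ - (fineOpPot Nf U (aK a L k) (((Nf : ℕ) : ℝ) ^ 2) m2 w)⁻¹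
      = (fineOp Nf U (aK a L k) (((Nf : ℕ) : ℝ) ^ 2) m2)⁻¹ * Matrix.diagonal w
          * (fineOpPot Nf U (aK a L k) (((Nf : ℕ) : ℝ) ^ 2) m2 w)⁻¹ := by
    rw [inv_sub_inv_of_isUnit _ _ hA hB, fineOpPot_sub_fineOp]
  have hdiff : effLaplacianPot Nf U (aK a L k) (((Nf : ℕ) : ℝ) ^ 2) m2 w - effLaplacian Nf U (aK a L k) (((Nf : ℕ) : ℝ) ^ 2) m2
      = (aK a L k ^ 2 * ((Nf : ℕ) : ℝ) ^ (d + 1)) •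
          (Qmat Nf U * (fineOp Nf U (aK a L k) (((Nf : ℕ) : ℝ) ^ 2) m2)⁻¹ * Matrix.diagonal w
            * ((fineOpPot Nf U (aK a L k) (((Nf : ℕ) : ℝ) ^ 2) m2 w)⁻¹ * (Qmat Nf U)ᵀ)) := by
    rw [effLaplacianPot, effLaplacian, sub_sub_sub_cancel_left, ← smul_sub, ← Matrix.sub_mul, ← Matrix.mul_sub, hres]
    simp only [Matrix.mul_assoc]
  rw [hdiff, Matrix.smul_apply, smul_eq_mul, Matrix.mul_apply, mul_sum, mul_sum]
  refine sum_congr rfl fun x _ => ?_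
  have hH : kingH L Nf U a m2 k b x = (aK a L k * ((Nf : ℕ) : ℝ) ^ (d + 1)) *
      (Qmat Nf U * (fineOp Nf U (aK a L k) (((Nf : ℕ) : ℝ) ^ 2) m2)⁻¹) b x := by
    rw [← kingHPot_zero, kingHPot, fineOpPot_zero', fineOp_inv_mul_transpose_Qmat, Matrix.transpose_apply]
  rw [Matrix.mul_diagonal, hH, kingHPot]
  field_simp
end Objects

/-! ## §2 The ℓ^∞ Neumann step and the size of the dressed minimiser in the window -/

section Size
/-- **THE ℓ^∞ NEUMANN STEP**: on a finite nonempty index set, if `f ≤ α + β·S` whenever `S` bounds `f`, with `α ≥ 0` and `0 ≤ β ≤ 1∕2`, then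
`f ≤ 2α` (take `S = max f`). [folklore] -/
theorem sup_bound_of_affine {ι : Type*} [Fintype ι] [Nonempty ι] (f : ι → ℝ) {α β : ℝ} (hα : 0 ≤ α)
    (hβ : β ≤ 1 / 2) (h : ∀ S : ℝ, (∀ y, f y ≤ S) → ∀ x, f x ≤ α + β * S) (x : ι) : f x ≤ 2 * α := by
  obtain ⟨x₀, -, hx₀⟩ := exists_max_image univ f univ_nonempty
  have hS : ∀ y, f y ≤ f x₀ := fun y => hx₀ y (mem_univ y)
  have h0 : f x₀ ≤ α + β * f x₀ := h (f x₀) hS x₀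
  have hmax : f x₀ ≤ 2 * α := by
    rcases lt_or_ge (f x₀) 0 with hneg | hnonneg
    · linarith
    · nlinarith
  exact (hS x).trans hmax

variable {L : ℕ} {Nf : ℕ} [NeZero Nf] {U : Fin (d + 1) → ℕ} [∀ μ, NeZero (U μ)] {a m2 : ℝ}
omit [NeZero Nf] [∀ μ, NeZero (U μ)] in
/-- The bound `w₀` of a potential is nonnegative (the fine torus is inhabited). [folklore] -/
theorem nonneg_of_abs_le {w : Tor (fine Nf U) → ℝ} {w₀ : ℝ} (hw : ∀ y, |w y| ≤ w₀) : 0 ≤ w₀ :=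
  (abs_nonneg _).trans (hw fun _ => 0)

/-- **THE SIZE OF THE DRESSED MINIMISER IN THE WINDOW**: if `|ℋ(x, b)| ≤ c_H`, the Riemann mass of `G` is `≤ C_M` (part 10a), `|w| ≤ w₀` and
`C_M·w₀ ≤ 1∕2`, then `|ℋ_w(x, b)| ≤ 2c_H` for all `x, b` (ℓ^∞ Neumann on the fixed point of §1).
[cite: King1986, (2.15) p.653, Theorem 3.3 (3.7) p.658] -/
theorem kingHPot_abs_le {k : ℕ} (hak : 0 ≤ aK a L k) (hm : 0 < m2) {w : Tor (fine Nf U) → ℝ}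
    (hB : IsUnit (fineOpPot Nf U (aK a L k) (((Nf : ℕ) : ℝ) ^ 2) m2 w)) {cH CM w₀ : ℝ} (hcH : 0 ≤ cH)
    (hH : ∀ (b : Tor U) (x : Tor (fine Nf U)), |kingH L Nf U a m2 k b x| ≤ cH)
    (hmass : ∀ x : Tor (fine Nf U),
      (((Nf : ℕ) : ℝ) ^ (d + 1))⁻¹ * ∑ y, |constrainedProp Nf U (aK a L k) (((Nf : ℕ) : ℝ) ^ 2) m2 x y| ≤ CM)
    (hw : ∀ y, |w y| ≤ w₀) (hwin : CM * w₀ ≤ 1 / 2) (b : Tor U) (x : Tor (fine Nf U)) :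
    |kingHPot L Nf U a m2 k w b x| ≤ 2 * cH := by
  have hw₀ := nonneg_of_abs_le hw
  have hNpos : (0 : ℝ) < ((Nf : ℕ) : ℝ) ^ (d + 1) := pow_pos (Nat.cast_pos.mpr (Nat.pos_of_ne_zero (NeZero.ne Nf))) _
  refine sup_bound_of_affine (fun y => |kingHPot L Nf U a m2 k w b y|) hcH hwin (fun S hS z => ?_) x
  have hS0 : 0 ≤ S := (abs_nonneg _).trans (hS z)
  rw [kingHPot_fixedPoint hak hm hB b z]
  have hterm : ∀ y, |constrainedProp Nf U (aK a L k) (((Nf : ℕ) : ℝ) ^ 2) m2 z y * w y * kingHPot L Nf U a m2 k w b y|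
      ≤ |constrainedProp Nf U (aK a L k) (((Nf : ℕ) : ℝ) ^ 2) m2 z y| * (w₀ * S) := fun y => by
    rw [abs_mul, abs_mul, mul_assoc]
    exact mul_le_mul_of_nonneg_left (mul_le_mul (hw y) (hS y) (abs_nonneg _) hw₀) (abs_nonneg _)
  calc |kingH L Nf U a m2 k b z - (((Nf : ℕ) : ℝ) ^ (d + 1))⁻¹ *
          ∑ y, constrainedProp Nf U (aK a L k) (((Nf : ℕ) : ℝ) ^ 2) m2 z y * w y * kingHPot L Nf U a m2 k w b y|
      ≤ |kingH L Nf U a m2 k b z| + |(((Nf : ℕ) : ℝ) ^ (d + 1))⁻¹ *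
          ∑ y, constrainedProp Nf U (aK a L k) (((Nf : ℕ) : ℝ) ^ 2) m2 z y * w y * kingHPot L Nf U a m2 k w b y| := abs_sub _ _
    _ ≤ cH + (((Nf : ℕ) : ℝ) ^ (d + 1))⁻¹ *
          ∑ y, |constrainedProp Nf U (aK a L k) (((Nf : ℕ) : ℝ) ^ 2) m2 z y| * (w₀ * S) := by
        refine add_le_add (hH b z) ?_
        rw [abs_mul, abs_of_pos (inv_pos.mpr hNpos)]
        exact mul_le_mul_of_nonneg_left ((abs_sum_le_sum_abs _ _).trans (sum_le_sum fun y _ => hterm y))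
          (inv_nonneg.mpr hNpos.le)
    _ = cH + (((Nf : ℕ) : ℝ) ^ (d + 1))⁻¹ *
          (∑ y, |constrainedProp Nf U (aK a L k) (((Nf : ℕ) : ℝ) ^ 2) m2 z y|) * (w₀ * S) := by
        rw [← Finset.sum_mul]
        ring
    _ ≤ cH + CM * (w₀ * S) := by
        have := mul_le_mul_of_nonneg_right (hmass z) (mul_nonneg hw₀ hS0)
        linarith
    _ = cH + CM * w₀ * S := by ring
end Size

/-! ## §3 The two-spacing sup bound of the dressed minimiser -/

section Step
variable (L : ℕ) [NeZero L] {U : Fin (d + 1) → ℕ} [∀ μ, NeZero (U μ)] {a m2 : ℝ}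
omit [NeZero L] [∀ μ, NeZero (U μ)] in
/-- The three-factor telescoping for a kernel–potential–kernel product: `|G′w′h′ − Gwh| ≤ |G′ − G||w′||h′| + |G|(|w′ − w||h′| + |w||h′ − h|)`. [folklore] -/
theorem abs_kernel3_sub_le (G G' w w' h h' : ℝ) :
    |G' * w' * h' - G * w * h| ≤ |G' - G| * |w'| * |h'| + |G| * (|w' - w| * |h'| + |w| * |h' - h|) := by
  have h1 := abs_mul3_sub_mul3_le G G' w w' h h'
  have e : |G' - G| * |w'| * |h'| + |G| * |w' - w| * |h'| + |G| * |w| * |h' - h|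
      = |G' - G| * |w'| * |h'| + |G| * (|w' - w| * |h'| + |w| * |h' - h|) := by ring
  linarith

/-- **THE TWO-SPACING SUP BOUND OF THE DRESSED MINIMISER.**  Two runs over the unit torus `U`: `L^k` and `L·L^k` fine points per unit side
(levels `k`, `k+1`), potentials `w`, `w′` with `A₀ + diag w`, `A₀′ + diag w′` invertible.  Numerical letters: `D₀ ≥ sup_{x′}|ℋ′(x′, b) − ℋ(x, b)|`
(the undressed Prop. 3.8 step, `x` under `x′`), `C_M ≥` the Riemann mass of the coarse propagator, `R ≥` the Riemann-sum two-spacing rate of the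
propagators (part 10a), `|w|, |w′| ≤ w₀`, coherence `|w′(y′) − w(y)| ≤ ν`, window `C_M·w₀ ≤ 1∕2`, `H′ ≥ sup|ℋ′_{w′}|`.  Then for every unit site
`b` and every fine point `x′` of the finer run:  `|ℋ′_{w′}(x′, b) − ℋ_w(x, b)| ≤ 2·(D₀ + R·(w₀H′) + C_M·(νH′))`.  Mechanism: subtract the two
fixed points of §1, move the coarse Riemann sum to the finer lattice by the fibre identity (`avg_comp_underPtN`), telescope the integrand,
and close by the ℓ^∞ Neumann step of §2. [cite: King1986, (2.15) p.653, Prop. 3.8 (3.71) p.664, p.664 (the pairing `x′ ∈ B^n(x)`)] -/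
theorem kingHPot_step_le {k : ℕ} (hak : 0 ≤ aK a L k) (hak' : 0 ≤ aK a L (k + 1)) (hm : 0 < m2)
    {w : Tor (fine (L ^ k) U) → ℝ} {w' : Tor (fine (L ^ 1 * L ^ k) U) → ℝ}
    (hB : IsUnit (fineOpPot (L ^ k) U (aK a L k) (((L ^ k : ℕ) : ℝ) ^ 2) m2 w))
    (hB' : IsUnit (fineOpPot (L ^ 1 * L ^ k) U (aK a L (k + 1)) (((L ^ 1 * L ^ k : ℕ) : ℝ) ^ 2) m2 w'))
    {D0 CM R w₀ ν H' : ℝ} (hD0 : 0 ≤ D0) (hCM : 0 ≤ CM) (hR : 0 ≤ R) (hH'0 : 0 ≤ H')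
    (hstep0 : ∀ (b : Tor U) (x' : Tor (fine (L ^ 1 * L ^ k) U)),
      |kingH L (L ^ 1 * L ^ k) U a m2 (k + 1) b x' - kingH L (L ^ k) U a m2 k b (underPtN L k 1 U x')| ≤ D0)
    (hmass : ∀ x : Tor (fine (L ^ k) U),
      (((L ^ k : ℕ) : ℝ) ^ (d + 1))⁻¹ * ∑ y, |constrainedProp (L ^ k) U (aK a L k) (((L ^ k : ℕ) : ℝ) ^ 2) m2 x y| ≤ CM)
    (hrate : ∀ x' : Tor (fine (L ^ 1 * L ^ k) U),
      (((L ^ 1 * L ^ k : ℕ) : ℝ) ^ (d + 1))⁻¹ *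
          ∑ y', |constrainedProp (L ^ 1 * L ^ k) U (aK a L (k + 1)) (((L ^ 1 * L ^ k : ℕ) : ℝ) ^ 2) m2 x' y'
            - constrainedProp (L ^ k) U (aK a L k) (((L ^ k : ℕ) : ℝ) ^ 2) m2 (underPtN L k 1 U x') (underPtN L k 1 U y')| ≤ R)
    (hw : ∀ y, |w y| ≤ w₀) (hw' : ∀ y', |w' y'| ≤ w₀) (hcoh : ∀ y', |w' y' - w (underPtN L k 1 U y')| ≤ ν)
    (hwin : CM * w₀ ≤ 1 / 2)
    (hH' : ∀ (b : Tor U) (y' : Tor (fine (L ^ 1 * L ^ k) U)), |kingHPot L (L ^ 1 * L ^ k) U a m2 (k + 1) w' b y'| ≤ H')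
    (b : Tor U) (x' : Tor (fine (L ^ 1 * L ^ k) U)) :
    |kingHPot L (L ^ 1 * L ^ k) U a m2 (k + 1) w' b x' - kingHPot L (L ^ k) U a m2 k w b (underPtN L k 1 U x')|
      ≤ 2 * (D0 + R * (w₀ * H') + CM * (ν * H')) := by
  have hw₀ : 0 ≤ w₀ := nonneg_of_abs_le hw
  have hν : 0 ≤ ν := (abs_nonneg _).trans (hcoh fun _ => 0)
  have hN'pos : (0 : ℝ) < (((L ^ 1 * L ^ k : ℕ) : ℝ)) ^ (d + 1) :=
    pow_pos (Nat.cast_pos.mpr (Nat.pos_of_ne_zero (NeZero.ne _))) _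
  set G := constrainedProp (L ^ k) U (aK a L k) (((L ^ k : ℕ) : ℝ) ^ 2) m2 with hGdef
  set G' := constrainedProp (L ^ 1 * L ^ k) U (aK a L (k + 1)) (((L ^ 1 * L ^ k : ℕ) : ℝ) ^ 2) m2 with hG'def
  refine sup_bound_of_affine
    (fun y' => |kingHPot L (L ^ 1 * L ^ k) U a m2 (k + 1) w' b y' - kingHPot L (L ^ k) U a m2 k w b (underPtN L k 1 U y')|)
    (α := D0 + R * (w₀ * H') + CM * (ν * H')) (β := CM * w₀) (by positivity) hwin (fun S hS z' => ?_) x'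
  have hS0 : 0 ≤ S := (abs_nonneg _).trans (hS z')
  set z := underPtN L k 1 U z' with hzdef
  have hfine := kingHPot_fixedPoint (L := L) (Nf := L ^ 1 * L ^ k) (U := U) (a := a) (m2 := m2) hak' hm hB' b z'
  have hcoarse := kingHPot_fixedPoint (L := L) (Nf := L ^ k) (U := U) (a := a) (m2 := m2) hak hm hB b z
  have hmove : (((L ^ k : ℕ) : ℝ) ^ (d + 1))⁻¹ * ∑ y, G z y * w y * kingHPot L (L ^ k) U a m2 k w b y
      = (((L ^ 1 * L ^ k : ℕ) : ℝ) ^ (d + 1))⁻¹ *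
          ∑ y', G z (underPtN L k 1 U y') * w (underPtN L k 1 U y') * kingHPot L (L ^ k) U a m2 k w b (underPtN L k 1 U y') :=
    (avg_comp_underPtN L U k (fun y => G z y * w y * kingHPot L (L ^ k) U a m2 k w b y)).symm
  have hmoveAbs : (((L ^ 1 * L ^ k : ℕ) : ℝ) ^ (d + 1))⁻¹ * ∑ y', |G z (underPtN L k 1 U y')|
      = (((L ^ k : ℕ) : ℝ) ^ (d + 1))⁻¹ * ∑ y, |G z y| :=
    avg_comp_underPtN L U k (fun y => |G z y|)
  have hdiff : kingHPot L (L ^ 1 * L ^ k) U a m2 (k + 1) w' b z' - kingHPot L (L ^ k) U a m2 k w b z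
      = (kingH L (L ^ 1 * L ^ k) U a m2 (k + 1) b z' - kingH L (L ^ k) U a m2 k b z)
        - (((L ^ 1 * L ^ k : ℕ) : ℝ) ^ (d + 1))⁻¹ *
          ∑ y', (G' z' y' * w' y' * kingHPot L (L ^ 1 * L ^ k) U a m2 (k + 1) w' b y'
            - G z (underPtN L k 1 U y') * w (underPtN L k 1 U y') * kingHPot L (L ^ k) U a m2 k w b (underPtN L k 1 U y')) := by
    rw [hfine, hcoarse, hmove, sum_sub_distrib, mul_sub]
    ring
  have hterm : ∀ y', |G' z' y' * w' y' * kingHPot L (L ^ 1 * L ^ k) U a m2 (k + 1) w' b y'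
        - G z (underPtN L k 1 U y') * w (underPtN L k 1 U y') * kingHPot L (L ^ k) U a m2 k w b (underPtN L k 1 U y')|
      ≤ |G' z' y' - G z (underPtN L k 1 U y')| * (w₀ * H') + |G z (underPtN L k 1 U y')| * (ν * H' + w₀ * S) := by
    intro y'
    refine (abs_kernel3_sub_le _ _ _ _ _ _).trans (add_le_add ?_ ?_)
    · rw [mul_assoc]
      exact mul_le_mul_of_nonneg_left (mul_le_mul (hw' y') (hH' b y') (abs_nonneg _) hw₀) (abs_nonneg _)
    · refine mul_le_mul_of_nonneg_left (add_le_add ?_ ?_) (abs_nonneg _)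
      · exact mul_le_mul (hcoh y') (hH' b y') (abs_nonneg _) hν
      · exact mul_le_mul (hw _) (hS y') (abs_nonneg _) hw₀
  have hsum : (((L ^ 1 * L ^ k : ℕ) : ℝ) ^ (d + 1))⁻¹ *
        ∑ y', |G' z' y' * w' y' * kingHPot L (L ^ 1 * L ^ k) U a m2 (k + 1) w' b y'
          - G z (underPtN L k 1 U y') * w (underPtN L k 1 U y') * kingHPot L (L ^ k) U a m2 k w b (underPtN L k 1 U y')|
      ≤ R * (w₀ * H') + CM * (ν * H' + w₀ * S) := by
    calc _ ≤ (((L ^ 1 * L ^ k : ℕ) : ℝ) ^ (d + 1))⁻¹ *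
          ∑ y', (|G' z' y' - G z (underPtN L k 1 U y')| * (w₀ * H') + |G z (underPtN L k 1 U y')| * (ν * H' + w₀ * S)) :=
          mul_le_mul_of_nonneg_left (sum_le_sum fun y' _ => hterm y') (inv_nonneg.mpr hN'pos.le)
      _ = (((L ^ 1 * L ^ k : ℕ) : ℝ) ^ (d + 1))⁻¹ * (∑ y', |G' z' y' - G z (underPtN L k 1 U y')|) * (w₀ * H')
          + (((L ^ 1 * L ^ k : ℕ) : ℝ) ^ (d + 1))⁻¹ * (∑ y', |G z (underPtN L k 1 U y')|) * (ν * H' + w₀ * S) := by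
          rw [sum_add_distrib, ← sum_mul, ← sum_mul]
          ring
      _ ≤ R * (w₀ * H') + CM * (ν * H' + w₀ * S) := by
          have h1 := hrate z'
          have h2 : (((L ^ 1 * L ^ k : ℕ) : ℝ) ^ (d + 1))⁻¹ * ∑ y', |G z (underPtN L k 1 U y')| ≤ CM := by
            rw [hmoveAbs]; exact hmass z
          have hνS : 0 ≤ ν * H' + w₀ * S := by positivity
          exact add_le_add (mul_le_mul_of_nonneg_right h1 (by positivity)) (mul_le_mul_of_nonneg_right h2 hνS)
  show |kingHPot L (L ^ 1 * L ^ k) U a m2 (k + 1) w' b z' - kingHPot L (L ^ k) U a m2 k w b (underPtN L k 1 U z')|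
      ≤ D0 + R * (w₀ * H') + CM * (ν * H') + CM * w₀ * S
  rw [← hzdef, hdiff]
  calc _ ≤ |kingH L (L ^ 1 * L ^ k) U a m2 (k + 1) b z' - kingH L (L ^ k) U a m2 k b z|
          + |(((L ^ 1 * L ^ k : ℕ) : ℝ) ^ (d + 1))⁻¹ *
            ∑ y', (G' z' y' * w' y' * kingHPot L (L ^ 1 * L ^ k) U a m2 (k + 1) w' b y'
              - G z (underPtN L k 1 U y') * w (underPtN L k 1 U y') * kingHPot L (L ^ k) U a m2 k w b (underPtN L k 1 U y'))| :=
        abs_sub _ _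
    _ ≤ D0 + (R * (w₀ * H') + CM * (ν * H' + w₀ * S)) := by
        refine add_le_add (by rw [hzdef]; exact hstep0 b z') ?_
        rw [abs_mul, abs_of_pos (inv_pos.mpr hN'pos)]
        exact (mul_le_mul_of_nonneg_left (abs_sum_le_sum_abs _ _) (inv_nonneg.mpr hN'pos.le)).trans hsum
    _ = D0 + R * (w₀ * H') + CM * (ν * H') + CM * w₀ * S := by ring
end Step

/-! ## §4 The two-spacing difference of the full perturbation, pointwise in the unit sites -/

section Pert
variable (L : ℕ) [NeZero L] {U : Fin (d + 1) → ℕ} [∀ μ, NeZero (U μ)] {a m2 : ℝ}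
/-- A block sum of a one-centred exponential: `Σ_z e^{−δ|z − b|} ≤ K_{d+1}(δ)` (the tree's `tdistT_sumBound`, symmetric distance). [cite: King1986, (4.41) p.675] -/
theorem sum_exp_centre_le {δ : ℝ} (hδ : 0 < δ) (b : Tor U) :
    ∑ z : Tor U, Real.exp (-(δ * tdistT U z b)) ≤ latticeConst (d + 1) δ := by
  have h := tdistT_sumBound U δ hδ b
  refine le_trans (le_of_eq (sum_congr rfl fun z _ => by rw [tdistT_symm U z b])) h

/-- **THE TWO-SPACING DIFFERENCE OF THE FULL PERTURBATION `E(w) = Δ_eff(w) − Δ_eff`, POINTWISE IN THE UNIT SITES.**  Two runs as in §3 with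
DECAYING letters for the undressed minimiser — `|ℋ(x, b)| ≤ c_H·e^{−δ|B(x) − b|}` (Theorem 3.3) and `|ℋ′(x′, b) − ℋ(x, b)| ≤ D₁·e^{−δ|B(x′) − b|}`
(Prop. 3.8 line 1) — sizes `|w|, |w′| ≤ w₀`, coherence `ν`, the dressed size `H′ ≥ sup|ℋ′_{w′}|` (§2) and the dressed step `S_d ≥ sup|ℋ′_{w′} − ℋ_w|`
(§3):  `|E′(w′)(b, b′) − E(w)(b, b′)| ≤ K_{d+1}(δ)·(D₁·(w₀H′) + c_H·(νH′ + w₀S_d))`.  Both entries are the exact Riemann sums of §1; the fibre identity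
`avg_comp_underPtN` pairs every fine point of the finer run with the point under it; one block sum (4.41).
[cite: King1986, (2.13)–(2.15) p.653, Theorem 3.3 (3.7) p.658, Prop. 3.8 (3.71) p.664, (4.39)–(4.41) p.675] -/
theorem effLaplacianPot_sub_step_le {k : ℕ} (hak : 0 ≤ aK a L k) (hak' : 0 ≤ aK a L (k + 1)) (hm : 0 < m2)
    {w : Tor (fine (L ^ k) U) → ℝ} {w' : Tor (fine (L ^ 1 * L ^ k) U) → ℝ}
    (hB : IsUnit (fineOpPot (L ^ k) U (aK a L k) (((L ^ k : ℕ) : ℝ) ^ 2) m2 w))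
    (hB' : IsUnit (fineOpPot (L ^ 1 * L ^ k) U (aK a L (k + 1)) (((L ^ 1 * L ^ k : ℕ) : ℝ) ^ 2) m2 w'))
    {cH D1 δ w₀ ν H' Sd : ℝ} (hcH : 0 ≤ cH) (hD1 : 0 ≤ D1) (hδ : 0 < δ) (hH'0 : 0 ≤ H') (hSd : 0 ≤ Sd)
    (hHdec : ∀ (b : Tor U) (x : Tor (fine (L ^ k) U)),
      |kingH L (L ^ k) U a m2 k b x| ≤ cH * Real.exp (-(δ * tdistT U (blockOf (L ^ k) U x) b)))
    (hstep : ∀ (b : Tor U) (x' : Tor (fine (L ^ 1 * L ^ k) U)),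
      |kingH L (L ^ 1 * L ^ k) U a m2 (k + 1) b x' - kingH L (L ^ k) U a m2 k b (underPtN L k 1 U x')|
        ≤ D1 * Real.exp (-(δ * tdistT U (blockOf (L ^ 1 * L ^ k) U x') b)))
    (hw : ∀ y, |w y| ≤ w₀) (hw' : ∀ y', |w' y'| ≤ w₀) (hcoh : ∀ y', |w' y' - w (underPtN L k 1 U y')| ≤ ν)
    (hH' : ∀ (b : Tor U) (y' : Tor (fine (L ^ 1 * L ^ k) U)), |kingHPot L (L ^ 1 * L ^ k) U a m2 (k + 1) w' b y'| ≤ H')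
    (hd : ∀ (b : Tor U) (y' : Tor (fine (L ^ 1 * L ^ k) U)),
      |kingHPot L (L ^ 1 * L ^ k) U a m2 (k + 1) w' b y' - kingHPot L (L ^ k) U a m2 k w b (underPtN L k 1 U y')| ≤ Sd)
    (b b' : Tor U) :
    |(effLaplacianPot (L ^ 1 * L ^ k) U (aK a L (k + 1)) (((L ^ 1 * L ^ k : ℕ) : ℝ) ^ 2) m2 w'
          - effLaplacian (L ^ 1 * L ^ k) U (aK a L (k + 1)) (((L ^ 1 * L ^ k : ℕ) : ℝ) ^ 2) m2) b b'
        - (effLaplacianPot (L ^ k) U (aK a L k) (((L ^ k : ℕ) : ℝ) ^ 2) m2 w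
          - effLaplacian (L ^ k) U (aK a L k) (((L ^ k : ℕ) : ℝ) ^ 2) m2) b b'|
      ≤ latticeConst (d + 1) δ * (D1 * (w₀ * H') + cH * (ν * H' + w₀ * Sd)) := by
  have hw₀ : 0 ≤ w₀ := nonneg_of_abs_le hw
  have hν : 0 ≤ ν := (abs_nonneg _).trans (hcoh fun _ => 0)
  rw [effLaplacianPot_sub_apply (L := L) hak' hm hB' b b', effLaplacianPot_sub_apply (L := L) hak hm hB b b',
    ← avg_comp_underPtN L U k (fun x => kingH L (L ^ k) U a m2 k b x * w x * kingHPot L (L ^ k) U a m2 k w b' x),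
    ← mul_sub, ← sum_sub_distrib]
  have hpt : ∀ x' : Tor (fine (L ^ 1 * L ^ k) U),
      |kingH L (L ^ 1 * L ^ k) U a m2 (k + 1) b x' * w' x' * kingHPot L (L ^ 1 * L ^ k) U a m2 (k + 1) w' b' x'
          - kingH L (L ^ k) U a m2 k b (underPtN L k 1 U x') * w (underPtN L k 1 U x')
              * kingHPot L (L ^ k) U a m2 k w b' (underPtN L k 1 U x')|
        ≤ (D1 * (w₀ * H') + cH * (ν * H' + w₀ * Sd)) * Real.exp (-(δ * tdistT U (blockOf (L ^ 1 * L ^ k) U x') b)) := by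
    intro x'
    set eb := Real.exp (-(δ * tdistT U (blockOf (L ^ 1 * L ^ k) U x') b)) with heb
    have heb0 : 0 ≤ eb := (Real.exp_pos _).le
    have hf : |kingH L (L ^ k) U a m2 k b (underPtN L k 1 U x')| ≤ cH * eb := by
      have h := hHdec b (underPtN L k 1 U x'); rwa [blockOf_underPtN] at h
    have htel := abs_kernel3_sub_le (kingH L (L ^ k) U a m2 k b (underPtN L k 1 U x')) (kingH L (L ^ 1 * L ^ k) U a m2 (k + 1) b x')
      (w (underPtN L k 1 U x')) (w' x') (kingHPot L (L ^ k) U a m2 k w b' (underPtN L k 1 U x'))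
      (kingHPot L (L ^ 1 * L ^ k) U a m2 (k + 1) w' b' x')
    refine htel.trans ?_
    calc |kingH L (L ^ 1 * L ^ k) U a m2 (k + 1) b x' - kingH L (L ^ k) U a m2 k b (underPtN L k 1 U x')| * |w' x'|
            * |kingHPot L (L ^ 1 * L ^ k) U a m2 (k + 1) w' b' x'|
          + |kingH L (L ^ k) U a m2 k b (underPtN L k 1 U x')|
            * (|w' x' - w (underPtN L k 1 U x')| * |kingHPot L (L ^ 1 * L ^ k) U a m2 (k + 1) w' b' x'|
              + |w (underPtN L k 1 U x')|
                * |kingHPot L (L ^ 1 * L ^ k) U a m2 (k + 1) w' b' x' - kingHPot L (L ^ k) U a m2 k w b' (underPtN L k 1 U x')|)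
        ≤ (D1 * eb) * w₀ * H' + (cH * eb) * (ν * H' + w₀ * Sd) := by
          refine add_le_add ?_ ?_
          · exact mul_le_mul (mul_le_mul (hstep b x') (hw' x') (abs_nonneg _) (by positivity)) (hH' b' x') (abs_nonneg _)
              (by positivity)
          · refine mul_le_mul hf (add_le_add ?_ ?_) (by positivity) (by positivity)
            · exact mul_le_mul (hcoh x') (hH' b' x') (abs_nonneg _) hν
            · exact mul_le_mul (hw _) (hd b' x') (abs_nonneg _) hw₀
      _ = (D1 * (w₀ * H') + cH * (ν * H' + w₀ * Sd)) * eb := by ring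
  calc _ ≤ ∑ z : Tor U, (D1 * (w₀ * H') + cH * (ν * H' + w₀ * Sd)) * Real.exp (-(δ * tdistT U z b)) :=
        abs_avg_sum_le_sum_blocks (L ^ 1 * L ^ k) U
          (G := fun z => (D1 * (w₀ * H') + cH * (ν * H' + w₀ * Sd)) * Real.exp (-(δ * tdistT U z b))) hpt
    _ = (D1 * (w₀ * H') + cH * (ν * H' + w₀ * Sd)) * ∑ z : Tor U, Real.exp (-(δ * tdistT U z b)) := by rw [mul_sum]
    _ ≤ (D1 * (w₀ * H') + cH * (ν * H' + w₀ * Sd)) * latticeConst (d + 1) δ :=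
        mul_le_mul_of_nonneg_left (sum_exp_centre_le hδ b) (by positivity)
    _ = _ := by ring
end Pert
end Summit.QuantumFields.YangMills.BalabanUVNodes.N15.KingModel

end
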